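import Mathlib

/-!
# A kernel-checked certificate for Romanov's constant `R₀ ≤ 1.94` — checker definitions

`R₀ = romanovConst = Σ_t f₁(t)/ord_t(2)` (`GoldbachLinnikRomanovConstant.lean`; print: `1.936 < R₀ < 1.94`,
[PintzRuzsa2003, (8.14)]).  `GoldbachLinnikRomanovConstBound.lean` certifies `R₀ ≤ 2.071` with the listed primes of
order `≤ 255`; this family of files (`GoldbachLinnikRomanovCert*.lean`) pushes the same sieve majorant
`E(x) = Σ_{ord t ≤ x} f₁(t) ≤ Φ_x` to `x < 2^15` with ALL primes of each order `e < 2^15` accounted for: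

* the data (`…Data.lean`) lists, for every `e < 2^15`, the primes `q ≤ 4 599 989` with `ord_q(2) = e`
  (12921 orders, 16677 primes), each certified in the kernel (`certAll`: `q ∣ 2^e − 1`,
  `gcd(q, 2^(e/r) − 1) = 1` for the prime divisors `r ∣ e`, and primality by trial division along `1 (mod s_e)`);
* completeness below `P₀ = 4 599 990` is certified by the COFACTOR CHECK (`cofCheck`): the number `c_e`, obtained from
  `2^e − 1` by stripping the factors of the `2^(e/r) − 1` and the listed primes, is coprime to the product of the
  prime table `LFunctions.ChainTable.table` (all primes `< 4.6·10^6`, `ChainTableFacts.tableOK`), by a remainder tree;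
  hence every unlisted prime of order `e` exceeds `P₀`, there are at most `⌊(e−1)/22⌋` of them, and they lie in the
  progression `1 (mod s_e)`; their inflation of the sieve weights is bounded by `W_e⁺/2^60` (`wOf`);
* the head `Σ_{x<2^15} U(x)/(x(x+1))` of the Abel-summed majorant is evaluated by Möbius inversion over the order
  classes with dyadic roundings at scale `2^60` (`headSums`: five integer accumulators and an overflow flag),
  the far range `x ≥ 2^15` is the one of `GoldbachLinnikRomanovConstBound` (`farV`, `A1Q`, `TjR 15`).

This file holds only the computable checker definitions (evaluated by `decide +kernel` in the `…Check*.lean` files);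
their soundness is `…Sound*.lean`, the assembly `…Top.lean` (`romanovConst_le_194`).  Design constraints honoured
here: strict accumulators (`seqN`/`seqB`), a binary records tree instead of arrays, fuel-bounded structural
recursion only, no `Nat.log2`/well-founded recursion inside kernel-evaluated code.

References: D. R. Heath-Brown, J.-C. Puchta, *Integers represented as a sum of primes and powers of two*,
Asian J. Math. 6 (2002) [HeathbrownPuchta2002] (§5: the quantity `R₀ = Σ_t f₁(t)/ξ(t)` and its numerical treatment);
J. Pintz, I. Z. Ruzsa, *On Linnik's approximation to Goldbach's problem, I*, Acta Arith. 109 (2003), 169–194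
[PintzRuzsa2003] ((8.14): `1.936 < R₀ < 1.94` in print).
-/

namespace Literature.NumberTheory.Sieve.RomanovCert

/-! ## Data decoding -/

/-- Base-`2^23` digit decoder: `k` digits of `code`, prepended to `rest`. [folklore] -/
def decodeDigits : ℕ → ℕ → List ℕ → List ℕ
  | 0, _, rest => rest
  | k + 1, code, rest => Nat.mod code 8388608 :: decodeDigits k (Nat.div code 8388608) rest

/-- Concatenated digit stream of the segments `(k, code)`. [folklore] -/
def digitsOf : List (ℕ × ℕ) → List ℕ
  | [] => []
  | (k, c) :: t => decodeDigits k c (digitsOf t)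

/-- Parse records `(e, k, q₁, …, q_k)` from a digit stream (fuel = record bound). [folklore] -/
def parseRecs : ℕ → List ℕ → List (ℕ × List ℕ)
  | 0, _ => []
  | _ + 1, [] => []
  | _ + 1, [_] => []
  | f + 1, e :: k :: rest => (e, rest.take k) :: parseRecs f (rest.drop k)

/-! ## Small-number arithmetic -/

/-- The 42 primes `≤ 181` (trial-division base for numbers `< 182²`). [folklore] -/
def smallPrimes : List ℕ :=
  [2, 3, 5, 7, 11, 13, 17, 19, 23, 29, 31, 37, 41, 43, 47, 53, 59, 61, 67, 71, 73, 79, 83, 89, 97,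
   101, 103, 107, 109, 113, 127, 131, 137, 139, 149, 151, 157, 163, 167, 173, 179, 181]

/-- Divide `q` out of `A` while it divides (fuel-bounded). [folklore] -/
def divOut : ℕ → ℕ → ℕ → ℕ
  | 0, A, _ => A
  | f + 1, A, q => bif Nat.beq (Nat.mod A q) 0 then divOut f (Nat.div A q) q else A

/-- Divide `p` out of `m`, counting: `(m / p^a, a)`. [folklore] -/
def divCount : ℕ → ℕ → ℕ → ℕ → ℕ × ℕ
  | 0, m, _, a => (m, a)
  | f + 1, m, p, a => bif Nat.beq (Nat.mod m p) 0 then divCount f (Nat.div m p) p (a + 1) else (m, a)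

/-- Factorisation of `0 < m < 182²` by trial division over the increasing prime list `ps`
(a leftover `> 1` is prime): list of `(p, multiplicity)`. [folklore] -/
def facSm : List ℕ → ℕ → List (ℕ × ℕ)
  | [], m => bif Nat.blt 1 m then [(m, 1)] else []
  | p :: ps, m =>
      bif Nat.blt m (p * p) then (bif Nat.blt 1 m then [(m, 1)] else [])
      else bif Nat.beq (Nat.mod m p) 0 then
        (let ma := divCount 20 (Nat.div m p) p 1; (p, ma.2) :: facSm ps ma.1)
      else facSm ps m

/-- Prime divisors of `m < 182²`. [folklore] -/
def pdivs (m : ℕ) : List ℕ := (facSm smallPrimes m).map Prod.fst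

/-- `ds ∪ p·ds ∪ … ∪ p^a·ds`. [folklore] -/
def expandP (p : ℕ) : ℕ → List ℕ → List ℕ
  | 0, ds => ds
  | a + 1, ds => ds ++ expandP p a (ds.map (· * p))

/-- All divisors from a factorisation. [folklore] -/
def divsOf : List (ℕ × ℕ) → List ℕ
  | [] => [1]
  | (p, a) :: t => expandP p a (divsOf t)

/-- Möbius value from a factorisation, as a tag: `0 ↦ μ = 0`, `1 ↦ μ = 1`, `2 ↦ μ = −1`. [folklore] -/
def muTag : List (ℕ × ℕ) → ℕ
  | [] => 1
  | (_, a) :: t =>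
      bif Nat.blt 1 a then 0
      else match muTag t with
        | 0 => 0
        | 1 => 2
        | _ => 1

/-! ## Parameters -/

/-- Dyadic precision `K = 60` of the roundings. [folklore] -/
def KK : ℕ := 60
/-- Head length `M = 2^15`. [folklore] -/
def MM : ℕ := 32768
/-- `P₀ = 4599990`: every prime `≤ P₀ − 1` is in the certified table `ChainTable.table`. [folklore] -/
def P0 : ℕ := 4599990
/-- Half-width of the key range of the records tree (`2^14`, depth `15`). [folklore] -/
def HALF : ℕ := 16384

/-! ## The records tree -/

/-- Binary tree over the keys `e ∈ [0, 2^15)`; the leaf at `e` holds `(W_e⁺, ∏(q−1), ∏(q−2), qs)`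
for the listed primes `qs` of order `e`. [folklore] -/
inductive Tr where
  | leaf (w bn bd : ℕ) (qs : List ℕ)
  | node (l r : Tr)

/-- The step `s_e` of the progression containing the primes of order `e` (`2e` for odd `e`). [folklore] -/
def sOf (e : ℕ) : ℕ := bif Nat.beq (Nat.mod e 2) 0 then e else 2 * e

/-- `⌈a / b⌉` on `ℕ` (for `0 < b`). [folklore] -/
def cdiv (a b : ℕ) : ℕ := Nat.div (a + b - 1) b

/-- One block `[j, j')` of the progression `b + i·s`: `⌈2^K (j' − j)/(b + j s − 2)⌉`. [folklore] -/
def blk (b s j j' : ℕ) : ℕ := cdiv (Nat.pow 2 KK * (j' - j)) (b + j * s - 2)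

/-- `W_e⁺ · 2^K`: an upper bound for `2^K · Σ_{i < N_e} 1/(b_e + i s_e − 2)` by three blocks,
`N_e = ⌊(e − 1)/22⌋`, `b_e` the least number `≥ P₀` that is `≡ 1 (mod s_e)`. [folklore] -/
def wOf (e : ℕ) : ℕ :=
  let N := Nat.div (e - 1) 22
  bif Nat.beq N 0 then 0 else
    let s := sOf e
    let b := P0 + Nat.mod (s - Nat.mod (P0 - 1) s) s
    let j1 := max 1 (Nat.div N 16)
    let j2 := max 1 (Nat.div N 4)
    blk b s 0 j1 + blk b s j1 j2 + blk b s j2 N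

/-- `∏ (q − c)` over a list. [folklore] -/
def prodSub (c : ℕ) : List ℕ → ℕ
  | [] => 1
  | q :: qs => (q - c) * prodSub c qs

/-- Build the records tree of depth `d` over the keys `[kl, kl + 2^d)`, merge-walking the records
(sorted by key); returns the tree and the unconsumed records. [folklore] -/
def buildTr : ℕ → ℕ → List (ℕ × List ℕ) → Tr × List (ℕ × List ℕ)
  | 0, e, recs =>
      match recs with
      | [] => (Tr.leaf (wOf e) 1 1 [], [])
      | (e', qs) :: t =>
          bif Nat.beq e' e then (Tr.leaf (wOf e) (prodSub 1 qs) (prodSub 2 qs) qs, t)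
          else (Tr.leaf (wOf e) 1 1 [], recs)
  | d + 1, kl, recs =>
      let L := buildTr d kl recs
      let R := buildTr d (kl + Nat.pow 2 d) L.2
      (Tr.node L.1 R.1, R.2)

/-- Lookup of the leaf at key `e` (`half = 2^(depth − 1)` at the root). [folklore] -/
def Tr.look : Tr → ℕ → ℕ → ℕ × ℕ × ℕ × List ℕ
  | Tr.leaf w bn bd qs, _, _ => (w, bn, bd, qs)
  | Tr.node l r, e, half =>
      bif Nat.blt e half then l.look e (Nat.div half 2) else r.look (e - half) (Nat.div half 2)

/-- The records tree of the certificate data. [folklore] -/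
def mkTree (recs : List (ℕ × List ℕ)) : Tr := (buildTr 15 0 recs).1

/-- The listed primes of order `e` (`e < 2^15`). [folklore] -/
def leafQs (tr : Tr) (e : ℕ) : List ℕ := (tr.look e HALF).2.2.2

/-! ## Record certification: every listed `q` is a prime with `ord_q(2) = e` -/

/-- No `c ≡ c₀ (mod s)` with `c₀ ≤ c`, `c² ≤ q` divides `q` (fuel-bounded upward search). [folklore] -/
def noCandDiv : ℕ → ℕ → ℕ → ℕ → Bool
  | 0, _, _, _ => false
  | f + 1, q, s, c =>
      bif Nat.blt q (c * c) then true
      else bif Nat.beq (Nat.mod q c) 0 then false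
      else noCandDiv f q s (c + s)

/-- Certificate for one `q`: `q ∣ 2^e − 1`, `gcd(q, 2^(e/r) − 1) = 1` for the prime divisors `r`
of `e`, and either `q < (e+1)²` or no divisor `≡ 1 (mod s_e)` up to `√q`. [folklore] -/
def certQ (e A : ℕ) (Bs : List ℕ) (q : ℕ) : Bool :=
  Nat.blt 1 q && Nat.beq (Nat.mod A q) 0 &&
  Bs.all (fun B => Nat.beq (Nat.gcd q (Nat.mod B q)) 1) &&
  (Nat.blt q ((e + 1) * (e + 1)) || noCandDiv 4096 q (sOf e) (1 + sOf e))

/-- Certificates for a strictly increasing list of `q`'s. [folklore] -/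
def certQs (e A : ℕ) (Bs : List ℕ) : ℕ → List ℕ → Bool
  | _, [] => true
  | prev, q :: qs => Nat.blt prev q && certQ e A Bs q && certQs e A Bs q qs

/-- Certificate for one leaf `(e, qs)`: empty, or `2 ≤ e` and every `q` certified. [folklore] -/
def certLeaf (e : ℕ) (qs : List ℕ) : Bool :=
  match qs with
  | [] => true
  | _ :: _ =>
      Nat.ble 2 e &&
      certQs e (Nat.pow 2 e - 1) ((pdivs e).map fun r => Nat.pow 2 (Nat.div e r) - 1) 0 qs

/-- Certify every leaf of the tree (keys `[kl, kl + 2·half)`). [folklore] -/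
def Tr.cert : Tr → ℕ → ℕ → Bool
  | Tr.leaf _ _ _ qs, e, _ => certLeaf e qs
  | Tr.node l r, kl, half => l.cert kl (Nat.div half 2) && r.cert (kl + half) (Nat.div half 2)

/-- The record certificate of the data. [folklore] -/
def certAll (recs : List (ℕ × List ℕ)) : Bool := (mkTree recs).cert 0 HALF

/-- `∏ (q − 1)` over all listed primes (tree product). [folklore] -/
def Tr.prodBn : Tr → ℕ
  | Tr.leaf _ bn _ _ => bn
  | Tr.node l r => l.prodBn * r.prodBn

/-- `∏ (q − 2)` over all listed primes (tree product). [folklore] -/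
def Tr.prodBd : Tr → ℕ
  | Tr.leaf _ _ bd _ => bd
  | Tr.node l r => l.prodBd * r.prodBd

/-- `⌈2^K · ∏ (q−1)/(q−2)⌉` over all listed primes. [folklore] -/
def aFup (recs : List (ℕ × List ℕ)) : ℕ :=
  let tr := mkTree recs
  cdiv (Nat.pow 2 KK * tr.prodBn) tr.prodBd

/-! ## Cofactor certificate: the unlisted primes of order `e` exceed the table bound -/

/-- Remove from `A` every prime factor it shares with `g` (iterated gcd, fuel-bounded). [folklore] -/
def stripG : ℕ → ℕ → ℕ → ℕ
  | 0, A, _ => A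
  | f + 1, A, g =>
      let d := Nat.gcd A g
      bif Nat.beq d 1 then A else stripG f (Nat.div A d) d

/-- Strip `2^(e/r) − 1` for each `r ∈ rs`. [folklore] -/
def stripAll (e : ℕ) : List ℕ → ℕ → ℕ
  | [], A => A
  | r :: rs, A => stripAll e rs (stripG 64 A (Nat.pow 2 (Nat.div e r) - 1))

/-- Divide every member of `qs` out of `A`. [folklore] -/
def divOutList : List ℕ → ℕ → ℕ
  | [], A => A
  | q :: qs, A => divOutList qs (divOut 64 A q)

/-- The cofactor `c_e`: `2^e − 1` stripped of the prime factors of the `2^(e/r) − 1` (`r ∣ e` prime)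
and of the listed primes `qs`. [folklore] -/
def cOf (e : ℕ) (qs : List ℕ) : ℕ :=
  divOutList qs (stripAll e (pdivs e) (Nat.pow 2 e - 1))

/-- Product tree over a list of moduli. [folklore] -/
inductive PTree where
  | leaf (c : ℕ)
  | node (p : ℕ) (l r : PTree)

/-- Root value of a product tree. [folklore] -/
def PTree.val : PTree → ℕ
  | leaf c => c
  | node p _ _ => p

/-- Product of a list. [folklore] -/
def lprod : List ℕ → ℕ
  | [] => 1
  | c :: t => c * lprod t

/-- Build a product tree (depth fuel). [folklore] -/
def buildPT : ℕ → List ℕ → PTree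
  | 0, l => PTree.leaf (lprod l)
  | d + 1, l =>
    match l with
    | [] => PTree.leaf 1
    | [c] => PTree.leaf c
    | _ :: _ :: _ =>
      let h := Nat.div l.length 2
      let lt := buildPT d (l.take h)
      let rt := buildPT d (l.drop h)
      PTree.node (lt.val * rt.val) lt rt

/-- Remainder-tree descent: every leaf modulus is coprime to `R`. [folklore] -/
def allCoprime : PTree → ℕ → Bool
  | PTree.leaf c, R => Nat.beq (Nat.gcd c (Nat.mod R c)) 1
  | PTree.node _ l r, R => allCoprime l (Nat.mod R l.val) && allCoprime r (Nat.mod R r.val)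

/-- One batch: all moduli coprime to `T`. [folklore] -/
def checkBatch (T : ℕ) (cur : List ℕ) : Bool :=
  let tr := buildPT 14 cur
  allCoprime tr (Nat.mod T tr.val)

/-- Binary-counter stack push (balanced products). [folklore] -/
def pushLvl : List (ℕ × ℕ) → ℕ → ℕ → List (ℕ × ℕ)
  | [], l, v => [(l, v)]
  | (l', v') :: t, l, v => bif Nat.beq l' l then pushLvl t (l + 1) (v' * v) else (l, v) :: (l', v') :: t

/-- Multiply out a stack. [folklore] -/
def mulStack : List (ℕ × ℕ) → ℕ → ℕ
  | [], acc => acc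
  | (_, v) :: t, acc => mulStack t (acc * v)

/-- Strict chunked product of a list (chunks of 64 into a binary-counter stack). [folklore] -/
def prodFold : ℕ → List ℕ → ℕ → ℕ → List (ℕ × ℕ) → ℕ
  | 0, _, _, acc, st => mulStack st acc
  | _ + 1, [], _, acc, st => mulStack st acc
  | f + 1, p :: rest, 0, acc, st => prodFold f rest 63 p (pushLvl st 0 acc)
  | f + 1, p :: rest, n + 1, acc, st => prodFold f rest n (acc * p) st

/-- Product of all members of a list (fuel = length bound). [folklore] -/
def listProd (fuel : ℕ) (l : List ℕ) : ℕ := prodFold fuel l 0 1 []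

/-- Main cofactor loop over `e ∈ [e, e + fuel)`; batches of `≈ bb` bits. [folklore] -/
def cofLoop (T bb : ℕ) (tr : Tr) : ℕ → ℕ → List ℕ → ℕ → Bool
  | 0, _, cur, _ => checkBatch T cur
  | f + 1, e, cur, bits =>
      let c := cOf e (leafQs tr e)
      let b := bits + e
      bif Nat.ble bb b then checkBatch T (c :: cur) && cofLoop T bb tr f (e + 1) [] 0
      else cofLoop T bb tr f (e + 1) (c :: cur) b

/-- The cofactor certificate on the order range `[e0, e0 + len)`: every `c_e` is coprime to the
product of the table `tbl`. [folklore] -/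
def cofCheck (tbl : List ℕ) (recs : List (ℕ × List ℕ)) (bb e0 len : ℕ) : Bool :=
  cofLoop (listProd 400000 tbl) bb (mkTree recs) len e0 [] 0

/-! ## Head sums (exact dyadic roundings) -/

/-- Accumulate `(X, Hn, Hd) = (Σ W_e⁺, ∏ ∏(q−1), ∏ ∏(q−2))` over a divisor list. [folklore] -/
def accDivs (tr : Tr) : List ℕ → ℕ → ℕ → ℕ → ℕ × ℕ × ℕ
  | [], X, hn, hd => (X, hn, hd)
  | e :: es, X, hn, hd =>
      let v := tr.look e HALF
      accDivs tr es (X + v.1) (hn * v.2.1) (hd * v.2.2.1)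

/-- `seqN x k = k`; makes the kernel evaluate `x` before continuing, so that accumulator
terms stay shallow during `decide` (strictness hint, semantically the identity). [folklore] -/
def seqN {α : Sort*} (x : ℕ) (k : α) : α := bif Nat.beq x x then k else k

/-- `seqB b k = k`; Boolean strictness hint. [folklore] -/
def seqB {α : Sort*} (b : Bool) (k : α) : α := bif b then k else k

/-- Möbius prefix data `(Σ_{μ=1} ⌈2^K/g⌉, Σ_{μ=-1} ⌊2^K/g⌋, #{μ=1}, #{μ=-1})`
over `g ∈ [g, g + fuel)` added to the accumulators. [folklore] -/
def muUp : ℕ → ℕ → ℕ → ℕ → ℕ → ℕ → ℕ × ℕ × ℕ × ℕ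
  | 0, _, mp, mn, p1, n1 => (mp, mn, p1, n1)
  | f + 1, g, mp, mn, p1, n1 =>
      match muTag (facSm smallPrimes g) with
      | 1 =>
        let mp' := mp + cdiv (Nat.pow 2 KK) g
        seqN mp' (muUp f (g + 1) mp' mn (p1 + 1) n1)
      | 2 =>
        let mn' := mn + Nat.div (Nat.pow 2 KK) g
        seqN mn' (muUp f (g + 1) mp mn' p1 (n1 + 1))
      | _ => muUp f (g + 1) mp mn p1 n1

/-- Remove `g ∈ (g − fuel, g]` (downward) from the Möbius prefix data. [folklore] -/
def muDown : ℕ → ℕ → ℕ → ℕ → ℕ → ℕ → ℕ × ℕ × ℕ × ℕ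
  | 0, _, mp, mn, p1, n1 => (mp, mn, p1, n1)
  | f + 1, g, mp, mn, p1, n1 =>
      match muTag (facSm smallPrimes g) with
      | 1 =>
        let mp' := mp - cdiv (Nat.pow 2 KK) g
        seqN mp' (muDown f (g - 1) mp' mn (p1 - 1) n1)
      | 2 =>
        let mn' := mn - Nat.div (Nat.pow 2 KK) g
        seqN mn' (muDown f (g - 1) mp mn' p1 (n1 - 1))
      | _ => muDown f (g - 1) mp mn p1 n1

/-- Head accumulators. [folklore] -/
structure HAcc where
  /-- `Σ ⌈Hn·mp/(Hd·d)⌉` [folklore] -/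
  tpos : ℕ
  /-- `Σ ⌊Hn·mn/(Hd·d)⌋` [folklore] -/
  tneg : ℕ
  /-- `Σ ⌈2^K·Hn·X/(Hd·(2^K − X)·d)⌉` [folklore] -/
  ipos : ℕ
  /-- `Σ ⌊2^K·Hn·P1/Hd⌋` [folklore] -/
  spos : ℕ
  /-- `Σ ⌈2^K·Hn·N1/Hd⌉` [folklore] -/
  sneg : ℕ
  /-- every `X_d < 2^K` [folklore] -/
  ok : Bool

/-- The head loop over `d ∈ [d, d + fuel)` with the Möbius window at `curx = ⌊(M−1)/d_prev⌋`. [folklore] -/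
def headLoop (tr : Tr) : ℕ → ℕ → ℕ → ℕ × ℕ × ℕ × ℕ → HAcc → HAcc
  | 0, _, _, _, acc => acc
  | f + 1, d, curx, mu, acc =>
      let xd := Nat.div (MM - 1) d
      let mu' := muDown (curx - xd) curx mu.1 mu.2.1 mu.2.2.1 mu.2.2.2
      let v := accDivs tr (divsOf (facSm smallPrimes d)) 0 1 1
      let X := v.1
      let hn := v.2.1
      let hd := v.2.2
      let sc := Nat.pow 2 KK
      let t1 := acc.tpos + cdiv (hn * mu'.1) (hd * d)
      let t2 := acc.tneg + Nat.div (hn * mu'.2.1) (hd * d)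
      let t3 := acc.ipos + cdiv (sc * hn * X) (hd * (sc - X) * d)
      let t4 := acc.spos + Nat.div (hn * mu'.2.2.1 * sc) hd
      let t5 := acc.sneg + cdiv (hn * mu'.2.2.2 * sc) hd
      let o := acc.ok && Nat.blt X sc
      seqN t1 (seqN t2 (seqN t3 (seqN t4 (seqN t5 (seqB o
        (headLoop tr f (d + 1) xd mu' ⟨t1, t2, t3, t4, t5, o⟩))))))

/-- Head sums over `d ∈ [dlo, dlo + len)` as `(Tpos, Tneg, Ipos, Spos, Sneg, ok)` (`0 < dlo`). [folklore] -/
def headSums (recs : List (ℕ × List ℕ)) (dlo len : ℕ) : ℕ × ℕ × ℕ × ℕ × ℕ × Bool :=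
  let tr := mkTree recs
  let x0 := Nat.div (MM - 1) dlo
  let mu := muUp x0 1 0 0 0 0
  let r := headLoop tr len dlo x0 mu ⟨0, 0, 0, 0, 0, true⟩
  (r.tpos, r.tneg, r.ipos, r.spos, r.sneg, r.ok)

end Literature.NumberTheory.Sieve.RomanovCert
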